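import Literature.NumberTheory.Automorphic.RankinSelbergTorusIntegral
import Literature.NumberTheory.Automorphic.WhittakerSphericalNonvanishing
import Literature.NumberTheory.Automorphic.WhittakerFactorizationGL2
import Literature.NumberTheory.Automorphic.JacquetLanglandsParts
import Literature.NumberTheory.Automorphic.CuspidalTypeSliceScalars
import Literature.NumberTheory.Automorphic.SmoothedCuspFormGeneric
import Literature.NumberTheory.Automorphic.SmoothedFormCentralCharacter
import Literature.NumberTheory.Automorphic.AdeleAddCharUnramified
import Literature.NumberTheory.Automorphic.TorusIntegrandThinSupport
import Literature.NumberTheory.Automorphic.UnipotentTateDomain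
import HarnessLib

/-!
# The Whittaker coefficient of an everywhere-unramified smoothed cusp form does not vanish at a
# point which is integral at every finite place

Topic `NumberTheory/Automorphic`; namespace `Literature.NumberTheory.Automorphic`. Theorems only (no
definition, no named fact). Cusp forms on `GL_n` are generic: the global Whittaker coefficient
`W_φ` of a non-zero smoothed `L²` cusp form `φ = S_η f` does not vanish identically
(`exists_whittakerCoeff_invQuot_smoothedForm_ne_zero_of_one_le`, Shalika (1974), Thm. 5.9). For the
archimedean reduction of the Rankin–Selberg method at LEVEL ONE one needs more: a point `g` with
`W_φ(g) ≠ 0` whose FINITE components all lie in `GL_n(𝒪_v)` (so that `g_f ∈ GL_n(𝒪̂_K)` acts through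
the level and `W_φ(g)` is an archimedean Whittaker function, `ArchRankinSelbergBridge`). This file
produces such a point by PEELING the finitely many places where a given `g` is not integral, using
the unramified local structure of `W_φ` at every finite place (Shintani / Casselman–Shalika, in the
tree's form `IsTorusUnramifiedAt`: right `GL_n(𝒪_v)`-invariance and the evaluation
`W(ι_v(ϖ^μ) g') = q_v^{-b(μ)/2} s_μ(x_v) W(g')` for `g'_v = 1`), the `N_n(𝔸_K)`-equivariance
`W(u g) = ψ(u) W(g)` and the central character (`W(g z) = ω(z) W(g)`):

* `finite_setOf_localComponent_not_mem_glInt` — an adelic matrix is integral at all but finitely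
  many places;
* `apply_stripAt_eq_zero_of_apply_eq_zero` / `apply_stripAt_ne_zero` (**peeling one place**) —
  with `g_v = u ϖ^m k` (local Iwasawa decomposition, `exists_unipotent_mul_zpowDiagGL_mul_glInt`) and
  `ϖ^m = ϖ^{m⁺} (ϖ 1)^{-N}` (`exists_natCast_add_const_neg`),
  `W(g) = ψ(ι_v u) · ω · q^{…} s_{m⁺}(x) · W(g^{(v)})` for the element `g^{(v)} = stripAt v g` with the
  same components as `g` except `1` at `v`; hence `W(g) ≠ 0 ⇒ W(g^{(v)}) ≠ 0`;
* `exists_apply_ne_zero_forall_localComponent_mem_glInt` — iterating over the finitely many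
  non-integral places: from `W(g₀) ≠ 0`, a `g` integral at every finite place with `W(g) ≠ 0`;
* `sndHom_mem_glFiniteIntegralLevel_of_forall_localComponent_mem_glInt` — such `g` has
  `g_f ∈ GL_n(𝒪̂_K)`;
* `exists_whittakerCoeff_smoothedForm_ne_zero_sndHom_mem_glFiniteIntegralLevel` (**main**) — for a
  cuspidal automorphic representation `Π` of `GL_n(𝔸_K)` (`n ≥ 1`) with a Satake family off `∅`
  (everywhere unramified), over a number field whose different is trivial (`𝔡_K = 1`, so Tate's
  character `ψ_v` has conductor `𝒪_v` at EVERY finite place), a test function `η` left invariant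
  under `K(1)` and `f ∈ Π` with `S_η f ≠ 0`: there is `g` with `g_f ∈ GL_n(𝒪̂_K)` and
  `W_{S_η f}(g) ≠ 0`.

In print this is the remark that the normalised spherical Whittaker function satisfies
`W°(1) = 1` (Cogdell (2004), Thm. 3.3; Casselman–Shalika (1980), Thm. 5.4), read globally: a
factorizable `W_φ = W_∞ ⊗ ⊗_v W°_v` that vanished on `G_∞ × GL_n(𝒪̂)` would vanish everywhere.

## References

* J. W. Cogdell, *Analytic theory of L-functions for GL_n* (2004), §1.1 (Cor. to Thm. 1.1), §3.1
  Thm. 3.3 [CogdellAnalyticTheory2004].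
* J. A. Shalika, *The multiplicity one theorem for GL_n*, Ann. of Math. 100 (1974), Thm. 5.9
  [Shalika1974].
* W. Casselman, J. Shalika, *The unramified principal series of p-adic groups II: the Whittaker
  function*, Compositio Math. 41 (1980), Thm. 5.4 [CasselmanShalika1980].
-/

noncomputable section

open MeasureTheory Measure NumberField IsDedekindDomain Matrix Set Filter
open scoped MatrixGroups ComplexConjugate
open Literature.NumberTheory.GaloisRepresentations (ideleGroup localUnits)
open Literature.NumberTheory.GaloisRepresentations.IsNonarchimedeanLocalField

namespace Literature.NumberTheory.Automorphic

open ValuativeRel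

/-! ### Finiteness of the non-integral places; integrality of the finite part -/

section Integral

variable {n : ℕ} {K : Type} [Field K] [NumberField K]

/-- **An adelic matrix is integral at all but finitely many finite places**: the set of `v` with
`g_v ∉ GL_n(𝒪_v)` is finite (the entries of `g` and of `g⁻¹` are adeles). [folklore] -/
theorem finite_setOf_localComponent_not_mem_glInt (g : GL (Fin n) (AdeleRing (𝓞 K) K)) :
    {v : HeightOneSpectrum (𝓞 K) | localComponent v g ∉ glInt n (v.adicCompletion K)}.Finite := by
  -- the finitely many bad places of the entries of `g` and of `g⁻¹`
  set A : Matrix (Fin n) (Fin n) (AdeleRing (𝓞 K) K) := (g : Matrix (Fin n) (Fin n) (AdeleRing (𝓞 K) K)) with hA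
  set B : Matrix (Fin n) (Fin n) (AdeleRing (𝓞 K) K) :=
    ((g⁻¹ : GL (Fin n) (AdeleRing (𝓞 K) K)) : Matrix (Fin n) (Fin n) (AdeleRing (𝓞 K) K)) with hB
  have h1 : ∀ i j : Fin n, {w : HeightOneSpectrum (𝓞 K) | (A i j).2 w ∉ w.adicCompletionIntegers K}.Finite :=
    fun i j => Filter.eventually_cofinite.1 (A i j).2.2
  have h2 : ∀ i j : Fin n, {w : HeightOneSpectrum (𝓞 K) | (B i j).2 w ∉ w.adicCompletionIntegers K}.Finite :=
    fun i j => Filter.eventually_cofinite.1 (B i j).2.2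
  refine ((Set.finite_iUnion fun i => Set.finite_iUnion fun j => h1 i j).union
    (Set.finite_iUnion fun i => Set.finite_iUnion fun j => h2 i j)).subset fun w hw => ?_
  by_contra hw'
  simp only [Set.mem_union, Set.mem_iUnion, Set.mem_setOf_eq, not_or, not_exists, not_not] at hw'
  refine hw (localComponent_mem_glInt (fun i j => ?_) (fun i j => ?_))
  · exact (HeightOneSpectrum.mem_adicCompletionIntegers (R := 𝓞 K) K w).1 (hw'.1 i j)
  · exact (HeightOneSpectrum.mem_adicCompletionIntegers (R := 𝓞 K) K w).1 (hw'.2 i j)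

/-- **Integral at every finite place ⟹ `g_f ∈ GL_n(𝒪̂_K)`.** [folklore] -/
theorem sndHom_mem_glFiniteIntegralLevel_of_forall_localComponent_mem_glInt
    {g : GL (Fin n) (AdeleRing (𝓞 K) K)}
    (h : ∀ v : HeightOneSpectrum (𝓞 K), localComponent v g ∈ glInt n (v.adicCompletion K)) :
    GLn.sndHom n K g ∈ glFiniteIntegralLevel n K := by
  rw [mem_glFiniteIntegralLevel_iff]
  refine ⟨fun i j => mem_integralFiniteAdeles_iff.2 fun v => ?_,
    fun i j => mem_integralFiniteAdeles_iff.2 fun v => ?_⟩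
  · have h1 := ((mem_glInt_iff _).1 (h v)).1 i j
    rw [mem_integer_adicCompletion_iff, AdelicGroupData.coe_map_adeleEval_apply,
      AdelicGroupData.adeleEval_apply] at h1
    change (((g : Matrix (Fin n) (Fin n) (AdeleRing (𝓞 K) K)) i j).2) v ∈ v.adicCompletionIntegers K
    rw [HeightOneSpectrum.mem_adicCompletionIntegers]
    exact h1
  · have h1 := ((mem_glInt_iff _).1 (h v)).2 i j
    rw [← map_inv, mem_integer_adicCompletion_iff, AdelicGroupData.coe_map_adeleEval_apply,
      AdelicGroupData.adeleEval_apply] at h1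
    rw [← map_inv]
    change ((((g⁻¹ : GL (Fin n) (AdeleRing (𝓞 K) K)) : Matrix (Fin n) (Fin n) (AdeleRing (𝓞 K) K)) i j).2) v ∈
      v.adicCompletionIntegers K
    rw [HeightOneSpectrum.mem_adicCompletionIntegers]
    exact h1

end Integral

/-! ### Peeling one place -/

section Peel

variable {n : ℕ} {K : Type} [Field K] [NumberField K] {v : HeightOneSpectrum (𝓞 K)}

/-- `ι_v(ϖ · 1_n)` is central in `GL_n(𝔸_K)` (`GLn.ofLocal_mem_center_of_scalar`). [folklore] -/
theorem ofLocal_heckeDiag_self_mem_center (ϖ : (v.adicCompletion K)ˣ) :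
    GLn.ofLocal n K v (heckeDiag n ϖ n) ∈ Subgroup.center (GL (Fin n) (AdeleRing (𝓞 K) K)) := by
  refine GLn.ofLocal_mem_center_of_scalar _ (ϖ : v.adicCompletion K) ?_
  rw [coe_heckeDiag]
  ext i j
  by_cases hij : i = j
  · subst hij
    rw [Matrix.diagonal_apply_eq, if_pos i.isLt, Matrix.scalar_apply, Matrix.diagonal_apply_eq]
  · rw [Matrix.diagonal_apply_ne _ hij, Matrix.scalar_apply, Matrix.diagonal_apply_ne _ hij]

/-- The components of `stripAt v g` off `v` are those of `g`. [folklore] -/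
theorem localComponent_stripAt_of_ne {w : HeightOneSpectrum (𝓞 K)} (h : w ≠ v)
    (g : GL (Fin n) (AdeleRing (𝓞 K) K)) :
    localComponent w (GLn.stripAt v g) = localComponent w g := by
  rw [GLn.stripAt, localComponent, map_mul, map_inv]
  have h1 : Matrix.GeneralLinearGroup.map (AdelicGroupData.adeleEval K w)
      (GLn.ofLocal n K v (Matrix.GeneralLinearGroup.map (AdelicGroupData.adeleEval K v) g)) = 1 :=
    GLn.toLocal_ofLocal_of_ne h _
  rw [h1, inv_one, mul_one]

/-- The `v`-component of `stripAt v g` is `1`, in particular integral. [folklore] -/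
theorem localComponent_stripAt_self (g : GL (Fin n) (AdeleRing (𝓞 K) K)) :
    localComponent v (GLn.stripAt v g) = 1 :=
  GLn.map_adeleEval_stripAt g

/-- **Peeling one place.** Let `W : GL_n(𝔸_K) → ℂ` be an unramified Whittaker–Hecke datum at `v`
(`IsTorusUnramifiedAt`: right `GL_n(𝒪_v)`-invariance and Shintani's evaluation on `ι_v(ϖ^μ) g'`,
`g'_v = 1`), transform by SOME scalar under left multiplication by `ι_v(N_n(K_v))` and under right
multiplication by the central elements `ι_v((ϖ 1_n)^{-N})`. If `W(stripAt v g) = 0` then `W(g) = 0`: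
writing `g_v = u ϖ^{m⁺} (ϖ 1)^{-N} k` (Iwasawa), `g = ι_v(u) · (ι_v(ϖ^{m⁺}) g^{(v)} ι_v(k)) · ι_v((ϖ 1)^{-N})`
and the four factors come out one by one. [cite: CogdellAnalyticTheory2004, §3.1 Thm. 3.3] -/
theorem apply_stripAt_eq_zero_of_apply_eq_zero {W : GL (Fin n) (AdeleRing (𝓞 K) K) → ℂ}
    {ϖ : (v.adicCompletion K)ˣ} {x : Fin n → ℂ} (hT : IsTorusUnramifiedAt n K W v ϖ x)
    (hN : ∀ u ∈ upperUnitriangular (Fin n) (v.adicCompletion K), ∀ g : GL (Fin n) (AdeleRing (𝓞 K) K),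
      ∃ c : ℂ, W (GLn.ofLocal n K v u * g) = c * W g)
    (hC : ∀ (N : ℕ) (g : GL (Fin n) (AdeleRing (𝓞 K) K)),
      ∃ c : ℂ, W (g * GLn.ofLocal n K v ((heckeDiag n ϖ n)⁻¹ ^ N)) = c * W g)
    {g : GL (Fin n) (AdeleRing (𝓞 K) K)} (hg : W (GLn.stripAt v g) = 0) : W g = 0 := by
  set gv : GL (Fin n) (v.adicCompletion K) := localComponent v g with hgv
  set g₁ : GL (Fin n) (AdeleRing (𝓞 K) K) := GLn.stripAt v g with hg₁
  have hg1v : Matrix.GeneralLinearGroup.map (AdelicGroupData.adeleEval K v) g₁ = 1 :=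
    GLn.map_adeleEval_stripAt g
  -- local Iwasawa decomposition at `v`
  have hϖu : IsUniformizingElement (ϖ : v.adicCompletion K) := isUniformizingElement_of_valued_eq K v hT.valued_eq
  obtain ⟨u, hu, m, k, hk, hdec⟩ := exists_unipotent_mul_zpowDiagGL_mul_glInt hϖu gv
  obtain ⟨mp, N, hm⟩ := exists_natCast_add_const_neg m
  have hz : zpowDiagGL hϖu.ne_zero m = piPowGL ϖ.ne_zero mp * (heckeDiag n ϖ n)⁻¹ ^ N := by
    rw [hm, zpowDiagGL_add, zpowDiagGL_natCast, zpowDiagGL_const_neg_natCast, Units.mk0_val]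
  -- commutation: `g₁` has trivial `v`-component, `ι_v((ϖ 1)^{-N})` is central
  have hcommk : GLn.ofLocal n K v k * g₁ = g₁ * GLn.ofLocal n K v k :=
    GLn.ofLocal_mul_eq_mul_ofLocal_of_toLocal_eq_one k hg1v
  have hcent : GLn.ofLocal n K v ((heckeDiag n ϖ n)⁻¹ ^ N) ∈ Subgroup.center (GL (Fin n) (AdeleRing (𝓞 K) K)) := by
    rw [map_pow, map_inv]
    exact Subgroup.pow_mem _ (Subgroup.inv_mem _ (ofLocal_heckeDiag_self_mem_center ϖ)) N
  have hcommc : ∀ X : GL (Fin n) (AdeleRing (𝓞 K) K),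
      GLn.ofLocal n K v ((heckeDiag n ϖ n)⁻¹ ^ N) * X = X * GLn.ofLocal n K v ((heckeDiag n ϖ n)⁻¹ ^ N) :=
    fun X => ((Subgroup.mem_center_iff.1 hcent) X).symm
  -- `g = ι_v(u) · ((ι_v(ϖ^{m⁺}) g₁ ι_v(k)) · ι_v((ϖ 1)^{-N}))`
  have hgdec : g = GLn.ofLocal n K v u *
      ((GLn.ofLocal n K v (piPowGL ϖ.ne_zero mp) * g₁ * GLn.ofLocal n K v k) *
        GLn.ofLocal n K v ((heckeDiag n ϖ n)⁻¹ ^ N)) := by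
    have h0 : g = GLn.ofLocal n K v gv * g₁ := by
      rw [GLn.ofLocal_mul_eq_mul_ofLocal_of_toLocal_eq_one gv hg1v]
      exact (GLn.stripAt_mul_ofLocal g).symm
    rw [h0, hdec, hz, map_mul, map_mul, map_mul]
    simp only [mul_assoc]
    congr 1
    rw [hcommk, hcommc (g₁ * GLn.ofLocal n K v k), mul_assoc]
  -- peel
  obtain ⟨c₁, hc₁⟩ := hN u hu ((GLn.ofLocal n K v (piPowGL ϖ.ne_zero mp) * g₁ * GLn.ofLocal n K v k) *
    GLn.ofLocal n K v ((heckeDiag n ϖ n)⁻¹ ^ N))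
  obtain ⟨c₂, hc₂⟩ := hC N (GLn.ofLocal n K v (piPowGL ϖ.ne_zero mp) * g₁ * GLn.ofLocal n K v k)
  rw [hgdec, hc₁, hc₂, hT.spherical k hk, hT.shintani g₁ hg1v mp, hg]
  simp

/-- **Peeling one place (non-vanishing form)**: `W(g) ≠ 0 ⟹ W(stripAt v g) ≠ 0`. [folklore] -/
theorem apply_stripAt_ne_zero {W : GL (Fin n) (AdeleRing (𝓞 K) K) → ℂ}
    {ϖ : (v.adicCompletion K)ˣ} {x : Fin n → ℂ} (hT : IsTorusUnramifiedAt n K W v ϖ x)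
    (hN : ∀ u ∈ upperUnitriangular (Fin n) (v.adicCompletion K), ∀ g : GL (Fin n) (AdeleRing (𝓞 K) K),
      ∃ c : ℂ, W (GLn.ofLocal n K v u * g) = c * W g)
    (hC : ∀ (N : ℕ) (g : GL (Fin n) (AdeleRing (𝓞 K) K)),
      ∃ c : ℂ, W (g * GLn.ofLocal n K v ((heckeDiag n ϖ n)⁻¹ ^ N)) = c * W g)
    {g : GL (Fin n) (AdeleRing (𝓞 K) K)} (hg : W g ≠ 0) : W (GLn.stripAt v g) ≠ 0 :=
  fun h => hg (apply_stripAt_eq_zero_of_apply_eq_zero hT hN hC h)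

/-- **Iterated peeling.** If `W` is an unramified Whittaker–Hecke datum at EVERY finite place (with
the scalar behaviour under `ι_v(N_n(K_v))` and under the central elements `ι_v((ϖ_v 1)^{-N})` of
`apply_stripAt_ne_zero`), then from one `g₀` with `W(g₀) ≠ 0` one gets `g`, integral at every finite
place, with `W(g) ≠ 0` (induction on the finite number of non-integral places of `g₀`). [folklore] -/
theorem exists_apply_ne_zero_forall_localComponent_mem_glInt {W : GL (Fin n) (AdeleRing (𝓞 K) K) → ℂ}
    (hT : ∀ v : HeightOneSpectrum (𝓞 K), ∃ (ϖ : (v.adicCompletion K)ˣ) (x : Fin n → ℂ),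
      IsTorusUnramifiedAt n K W v ϖ x ∧
        ∀ (N : ℕ) (g : GL (Fin n) (AdeleRing (𝓞 K) K)),
          ∃ c : ℂ, W (g * GLn.ofLocal n K v ((heckeDiag n ϖ n)⁻¹ ^ N)) = c * W g)
    (hN : ∀ (v : HeightOneSpectrum (𝓞 K)), ∀ u ∈ upperUnitriangular (Fin n) (v.adicCompletion K),
      ∀ g : GL (Fin n) (AdeleRing (𝓞 K) K), ∃ c : ℂ, W (GLn.ofLocal n K v u * g) = c * W g)
    {g₀ : GL (Fin n) (AdeleRing (𝓞 K) K)} (hg₀ : W g₀ ≠ 0) :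
    ∃ g : GL (Fin n) (AdeleRing (𝓞 K) K),
      (∀ v : HeightOneSpectrum (𝓞 K), localComponent v g ∈ glInt n (v.adicCompletion K)) ∧ W g ≠ 0 := by
  classical
  -- induction on the number of non-integral places
  suffices h : ∀ (N : ℕ) (g : GL (Fin n) (AdeleRing (𝓞 K) K)),
      {v : HeightOneSpectrum (𝓞 K) | localComponent v g ∉ glInt n (v.adicCompletion K)}.ncard ≤ N →
        W g ≠ 0 → ∃ g' : GL (Fin n) (AdeleRing (𝓞 K) K),
          (∀ v : HeightOneSpectrum (𝓞 K), localComponent v g' ∈ glInt n (v.adicCompletion K)) ∧ W g' ≠ 0 from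
    h _ g₀ le_rfl hg₀
  intro N
  induction N with
  | zero =>
    intro g hcard hg
    refine ⟨g, fun v => ?_, hg⟩
    by_contra hv
    have hmem : v ∈ {v : HeightOneSpectrum (𝓞 K) | localComponent v g ∉ glInt n (v.adicCompletion K)} := hv
    have hpos : 0 < {v : HeightOneSpectrum (𝓞 K) | localComponent v g ∉ glInt n (v.adicCompletion K)}.ncard :=
      Set.ncard_pos (finite_setOf_localComponent_not_mem_glInt g) |>.2 ⟨v, hmem⟩
    omega
  | succ N ih =>
    intro g hcard hg
    by_cases hall : ∀ v : HeightOneSpectrum (𝓞 K), localComponent v g ∈ glInt n (v.adicCompletion K)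
    · exact ⟨g, hall, hg⟩
    obtain ⟨v, hv⟩ := not_forall.1 hall
    obtain ⟨ϖ, x, hTv, hCv⟩ := hT v
    have hg₁ : W (GLn.stripAt v g) ≠ 0 := apply_stripAt_ne_zero hTv (hN v) hCv hg
    refine ih (GLn.stripAt v g) ?_ hg₁
    -- the bad set of `stripAt v g` is the bad set of `g` minus `v`
    have hsub : {w : HeightOneSpectrum (𝓞 K) | localComponent w (GLn.stripAt v g) ∉ glInt n (w.adicCompletion K)} ⊆
        {w : HeightOneSpectrum (𝓞 K) | localComponent w g ∉ glInt n (w.adicCompletion K)} \ {v} := by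
      intro w hw
      have hwv : w ≠ v := by
        rintro rfl
        exact hw (by rw [localComponent_stripAt_self]; exact one_mem _)
      refine ⟨?_, hwv⟩
      change localComponent w (GLn.stripAt v g) ∉ _ at hw
      rw [localComponent_stripAt_of_ne hwv] at hw
      exact hw
    have hfin := finite_setOf_localComponent_not_mem_glInt g
    have hmem : v ∈ {w : HeightOneSpectrum (𝓞 K) | localComponent w g ∉ glInt n (w.adicCompletion K)} := hv
    have h1 := Set.ncard_le_ncard hsub hfin.sdiff
    rw [Set.ncard_sdiff_singleton_of_mem hmem] at h1
    omega

end Peel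

/-! ### Level-one smoothed cusp forms -/

section LevelOne

variable {n : ℕ} {K : Type} [Field K] [NumberField K]
  {μ : Measure (AdelicGroupData.gl n K).automorphicQuotient} [(AdelicGroupData.gl n K).IsAutomorphicMeasure μ]

variable [MeasurableSpace (AdeleRing (𝓞 K) K)] [BorelSpace (AdeleRing (𝓞 K) K)]
variable [MeasurableSpace (GL (Fin n) (AdeleRing (𝓞 K) K))] [BorelSpace (GL (Fin n) (AdeleRing (𝓞 K) K))]

omit [NumberField K] [(AdelicGroupData.gl n K).IsAutomorphicMeasure μ] [MeasurableSpace (AdeleRing (𝓞 K) K)]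
  [BorelSpace (AdeleRing (𝓞 K) K)] [MeasurableSpace (GL (Fin n) (AdeleRing (𝓞 K) K))]
  [BorelSpace (GL (Fin n) (AdeleRing (𝓞 K) K))] in
/-- `v ∤ 1`: no finite prime divides the unit ideal. [folklore] -/
theorem not_asIdeal_dvd_top (v : HeightOneSpectrum (𝓞 K)) : ¬ v.asIdeal ∣ (⊤ : Ideal (𝓞 K)) := fun h =>
  v.isPrime.ne_top (top_le_iff.1 (Ideal.le_of_dvd h))

/-- **The Whittaker coefficient of an everywhere-unramified smoothed cusp form is non-zero at a point
with integral finite part** (main). Let `Π` be a cuspidal automorphic representation of `GL_n(𝔸_K)`,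
`n ≥ 1`, with a Satake family `α` off the EMPTY set (a non-zero `K(1)`-fixed Hecke eigenvector at every
finite place), over a number field with trivial different (so that Tate's character has conductor
`𝒪_v` everywhere), `η` a test function left invariant under `K(1)` and `f ∈ Π` with `S_η f ≠ 0`. Then
there is `g ∈ GL_n(𝔸_K)` with `g_f ∈ GL_n(𝒪̂_K)` and `W_{S_η f}(g) ≠ 0` (Tate's box, character and any
Haar measure on `N_n(𝔸_K)`): genericity gives `g₀` with `W(g₀) ≠ 0`, and the non-integral places of
`g₀` are peeled off (`exists_apply_ne_zero_forall_localComponent_mem_glInt`) using the unramified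
structure of `W` at every place (`exists_isTorusUnramifiedAt_whittakerCoeff_smoothedForm`), the
`N_n(𝔸_K)`-equivariance (`whittakerCoeff_unipotent_mul`) and the central character of `Π`
(`exists_centralCharacter_smoothedForm`). [cite: CogdellAnalyticTheory2004, §1.1 and §3.1 Thm. 3.3]
[cite: Shalika1974, §5 Thm. 5.9] -/
theorem exists_whittakerCoeff_smoothedForm_ne_zero_sndHom_mem_glFiniteIntegralLevel (hn : 1 ≤ n)
    (hd : differentIdeal ℤ (𝓞 K) = ⊤)
    (P : CuspidalAutomorphicRepGL n K μ) {α : SatakeFamily K} (hα : IsSatakeFamilyOf P ∅ α)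
    (ν₀ : Measure ↥(adelicUnipotent n K)) [IsHaarMeasure ν₀]
    {η : (AdelicGroupData.gl n K).Adelic → ℝ} (hη : IsTestFunctionGL n K η)
    (hηK : ∀ k : (AdelicGroupData.gl n K).Adelic, k ∈ principalCongruenceLevel n K ⊤ →
      ∀ g : (AdelicGroupData.gl n K).Adelic, η (k * g) = η g)
    (f : P.1.toSubmodule) (hne : smoothedForm η (f : (AdelicGroupData.gl n K).L2 μ) ≠ 0) :
    ∃ g : GL (Fin n) (AdeleRing (𝓞 K) K), GLn.sndHom n K g ∈ glFiniteIntegralLevel n K ∧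
      whittakerCoeff ν₀ (unipotentTateDomain n K) (adeleAddChar K)
        (invQuot (AdelicGroupData.gl n K) (smoothedForm η (f : (AdelicGroupData.gl n K).L2 μ))) g ≠ 0 := by
  classical
  haveI := isMulRightInvariant_of_isHaarMeasure_adelicUnipotent ν₀
  have hψ : IsGlobalAddChar K (adeleAddChar K) := isGlobalAddChar_adeleAddChar (K := K)
  have h𝓕 : IsFundamentalDomain ↥(rationalUnipotent n K) (unipotentTateDomain n K) ν₀ :=
    isFundamentalDomain_unipotentTateDomain ν₀
  have h𝓕c : IsCompact (closure (unipotentTateDomain n K)) := isCompact_closure_unipotentTateDomain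
  set φ : GL (Fin n) (AdeleRing (𝓞 K) K) → ℂ :=
    invQuot (AdelicGroupData.gl n K) (smoothedForm η (f : (AdelicGroupData.gl n K).L2 μ)) with hφ
  have hφinv : IsLeftInvariant (AdelicGroupData.gl n K) φ := isLeftInvariant_invQuot _ _
  set W : GL (Fin n) (AdeleRing (𝓞 K) K) → ℂ :=
    whittakerCoeff ν₀ (unipotentTateDomain n K) (adeleAddChar K) φ with hW
  -- genericity
  obtain ⟨g₀, hg₀⟩ := exists_whittakerCoeff_invQuot_smoothedForm_ne_zero_of_one_le hn hη.continuous
    hη.hasCompactSupport (P.le_cuspidalSubspace f.2) hne ν₀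
  -- the central character
  obtain ⟨ω, -, -, -, -, -, hωφ⟩ := P.exists_centralCharacter_smoothedForm
  -- the unramified structure at every finite place
  have hT : ∀ v : HeightOneSpectrum (𝓞 K), ∃ (ϖ : (v.adicCompletion K)ˣ) (x : Fin n → ℂ),
      IsTorusUnramifiedAt n K W v ϖ x ∧
        ∀ (N : ℕ) (g : GL (Fin n) (AdeleRing (𝓞 K) K)),
          ∃ c : ℂ, W (g * GLn.ofLocal n K v ((heckeDiag n ϖ n)⁻¹ ^ N)) = c * W g := by
    intro v
    obtain ⟨x, hx⟩ := exists_univ_val_map_eq (hα.card_eq (Set.notMem_empty v))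
    have hdv : ¬ v.asIdeal ∣ differentIdeal ℤ (𝓞 K) := by rw [hd]; exact not_asIdeal_dvd_top v
    obtain ⟨hψv, hψv'⟩ := adicComponent_adeleAddChar_unramified (K := K) hdv
    have htop : (⊤ : Ideal (𝓞 K)) ≠ 0 := top_ne_bot
    obtain ⟨ϖ, hTv⟩ := exists_isTorusUnramifiedAt_whittakerCoeff_smoothedForm P hα htop (Set.notMem_empty v)
      (not_asIdeal_dvd_top v) hη.continuous hη.hasCompactSupport hηK f hx h𝓕 h𝓕c hψ hψv hψv'
    refine ⟨ϖ, x, hTv, fun N g => ?_⟩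
    -- `ι_v((ϖ 1)^{-N})` is the global scalar matrix of the idele `(localUnits v ϖ)^{-N}`
    set w : ideleGroup K := (localUnits v ϖ)⁻¹ ^ N with hw
    have hsc : GLn.ofLocal n K v ((heckeDiag n ϖ n)⁻¹ ^ N) = Matrix.GeneralLinearGroup.scalar (Fin n) w := by
      rw [map_pow, map_inv, heckeDiag_self_eq_scalar, ← glDiagonal_const_eq_scalar, ofLocal_glDiagonal_const,
        hw, map_pow, map_inv]
    have hcomm : ∀ y : GL (Fin n) (AdeleRing (𝓞 K) K),
        y * Matrix.GeneralLinearGroup.scalar (Fin n) w = Matrix.GeneralLinearGroup.scalar (Fin n) w * y :=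
      fun y => (Subgroup.mem_center_iff.1 (generalLinearGroup_scalar_mem_center (n := n) (K := K) w)) y
    have h : ∀ u : GL (Fin n) (AdeleRing (𝓞 K) K),
        φ (u * (g * Matrix.GeneralLinearGroup.scalar (Fin n) w)) = ((ω w : ℂˣ) : ℂ) * φ (u * g) := fun u => by
      rw [hcomm g, ← mul_assoc, hcomm u, mul_assoc]
      exact hωφ η f w (u * g)
    refine ⟨((ω w : ℂˣ) : ℂ), ?_⟩
    rw [hsc]
    simp only [hW, whittakerCoeff_def, h, mul_assoc]
    rw [integral_const_mul]
    exact (mul_smul_comm _ _ _).symm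
  -- `N_n(𝔸_K)`-equivariance under `ι_v(N_n(K_v))`
  have hN : ∀ (v : HeightOneSpectrum (𝓞 K)), ∀ u ∈ upperUnitriangular (Fin n) (v.adicCompletion K),
      ∀ g : GL (Fin n) (AdeleRing (𝓞 K) K), ∃ c : ℂ, W (GLn.ofLocal n K v u * g) = c * W g :=
    fun v u hu g => ⟨whittakerCharFun (adeleAddChar K) ⟨GLn.ofLocal n K v u, ofLocal_mem_adelicUnipotent hu⟩,
      whittakerCoeff_unipotent_mul h𝓕 hψ hφinv ⟨GLn.ofLocal n K v u, ofLocal_mem_adelicUnipotent hu⟩ g⟩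
  obtain ⟨g, hgint, hg⟩ := exists_apply_ne_zero_forall_localComponent_mem_glInt hT hN hg₀
  exact ⟨g, sndHom_mem_glFiniteIntegralLevel_of_forall_localComponent_mem_glInt hgint, hg⟩

end LevelOne

end Literature.NumberTheory.Automorphic
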